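import Summits.BirchSwinnertonDyer.BirchSwinnertonDyer.Theorems.ManinLocalTwoThreeEtaIdentitiesTwentyFour
import HarnessLib

/-!
# The Euler functions at level 48: `x`, `y`, `φ₄₈` as `q`-monomials times Euler functions, their derivatives, and
# `E₂, E₄, E₆, E₈` (and derivatives) modulo `o(q⁹)`

Cell bsd-f2-manin, route `ManinLocalTwoThree` (crux C2 `ManinOddAtFour`, stmt-22967: `2² ∣ 48`), prover seat p2 gen 26; the level-`48`
analogue of `EulerRemaindersTwentyFour` — toolkit for the three limits (T1)₄₈–(T3)₄₈ of `EtaIdentityReductionFortyEight`.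
With `E_δ(τ) = ∏_{n ≥ 1} (1 − q^{δn})` (`eulerFn δ`), `q = e^{2πiτ}`:

* `x = η₈⁴η₁₂²/(η₄²η₂₄⁴) = E₈⁴E₁₂²/(q²E₄²E₂₄⁴)`, `y = η₂η₆η₈³η₁₂²/(η₄²η₂₄⁵) = E₂E₆E₈³E₁₂²/(q³E₄²E₂₄⁵)`,
  `φ₄₈ = η₄⁴η₁₂⁴/(η₂η₆η₈η₂₄) = qE₄⁴E₁₂⁴/(E₂E₆E₈E₂₄)` (`x48_eq`, `y48_eq`, `phi48_eq`);
* the logarithmic derivatives `deriv_x48`, `deriv_y48`;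
* `E₂ = 1 − q² − q⁴`, `E₄ = 1 − q⁴ − q⁸`, `E₆ = 1 − q⁶`, `E₈ = 1 − q⁸` modulo `o(q⁹)` and the matching derivative truncations
  (the Sturm bound at level `48` needs the identities to order `q⁶`, hence Euler truncations to order `9`).

No definition, no named fact, no sorry; nothing here proves C2, Manin's conjecture or BSD. [folklore] -/

set_option autoImplicit false
-- lint-debt: the directory name repeats the summit name (sibling precedent `ManinLocalTwoThreeEulerRemaindersTwentyFour.lean`)
set_option linter.dupNamespace false

noncomputable section

open Complex Filter Topology Set Asymptotics Polynomial
open UpperHalfPlane hiding I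
open scoped Real Topology Manifold MatrixGroups
open Literature.NumberTheory.EllipticCurves Literature.NumberTheory.EllipticCurves.ModularForms

namespace Summit.BirchSwinnertonDyer.BirchSwinnertonDyer.Theorems.ManinLocalTwoThree.EulerRemaindersFortyEight

open QRemainder EulerRemainders
open LigozatIdentities (hasDerivAt_eulerFn_comp)

/-! ## §1 `x`, `y`, `φ₄₈` in terms of `q` and the Euler functions -/

/-- **`x = η₈⁴η₁₂²/(η₄²η₂₄⁴) = E₈⁴E₁₂²/(q² E₄² E₂₄⁴)`.** [folklore] -/
theorem x48_eq (τ : ℍ) :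
    etaQuotient 48 (expFn [(4, -2), (8, 4), (12, 2), (24, -4)]) τ
      = eulerFn 8 τ ^ 4 * eulerFn 12 τ ^ 2
        / (Function.Periodic.qParam 1 (τ : ℂ) ^ 2 * eulerFn 4 τ ^ 2 * eulerFn 24 τ ^ 4) := by
  have hE4 := eulerFn_ne_zero (by norm_num : 0 < 4) τ
  have hE24 := eulerFn_ne_zero (by norm_num : 0 < 24) τ
  have hq := qParam_ne_zero τ
  rw [etaQuotient_eq_cexp_mul_prod, show Nat.divisors 48 = {1, 2, 3, 4, 6, 8, 12, 16, 24, 48} by decide]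
  have hsum : (∑ δ ∈ ({1, 2, 3, 4, 6, 8, 12, 16, 24, 48} : Finset ℕ),
      (δ : ℤ) * expFn [(4, -2), (8, 4), (12, 2), (24, -4)] δ) = (-(24 * 2 : ℕ) : ℤ) := by decide
  rw [hsum, cexp_neg_eq_inv_qParam_pow]
  rw [Finset.prod_insert (by decide), Finset.prod_insert (by decide), Finset.prod_insert (by decide), Finset.prod_insert (by decide), Finset.prod_insert (by decide), Finset.prod_insert (by decide), Finset.prod_insert (by decide), Finset.prod_insert (by decide), Finset.prod_insert (by decide),
    Finset.prod_singleton]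
  rw [show expFn [(4, -2), (8, 4), (12, 2), (24, -4)] 1 = 0 by decide,
    show expFn [(4, -2), (8, 4), (12, 2), (24, -4)] 2 = 0 by decide,
    show expFn [(4, -2), (8, 4), (12, 2), (24, -4)] 3 = 0 by decide,
    show expFn [(4, -2), (8, 4), (12, 2), (24, -4)] 4 = (-2) by decide,
    show expFn [(4, -2), (8, 4), (12, 2), (24, -4)] 6 = 0 by decide,
    show expFn [(4, -2), (8, 4), (12, 2), (24, -4)] 8 = 4 by decide,
    show expFn [(4, -2), (8, 4), (12, 2), (24, -4)] 12 = 2 by decide,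
    show expFn [(4, -2), (8, 4), (12, 2), (24, -4)] 16 = 0 by decide,
    show expFn [(4, -2), (8, 4), (12, 2), (24, -4)] 24 = (-4) by decide,
    show expFn [(4, -2), (8, 4), (12, 2), (24, -4)] 48 = 0 by decide]
  simp only [zpow_neg, zpow_ofNat]
  field_simp

/-- **`y = η₂η₆η₈³η₁₂²/(η₄²η₂₄⁵) = E₂E₆E₈³E₁₂²/(q³ E₄² E₂₄⁵)`.** [folklore] -/
theorem y48_eq (τ : ℍ) :
    etaQuotient 48 (expFn [(2, 1), (4, -2), (6, 1), (8, 3), (12, 2), (24, -5)]) τ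
      = eulerFn 2 τ * eulerFn 6 τ * eulerFn 8 τ ^ 3 * eulerFn 12 τ ^ 2
        / (Function.Periodic.qParam 1 (τ : ℂ) ^ 3 * eulerFn 4 τ ^ 2 * eulerFn 24 τ ^ 5) := by
  have hE4 := eulerFn_ne_zero (by norm_num : 0 < 4) τ
  have hE24 := eulerFn_ne_zero (by norm_num : 0 < 24) τ
  have hq := qParam_ne_zero τ
  rw [etaQuotient_eq_cexp_mul_prod, show Nat.divisors 48 = {1, 2, 3, 4, 6, 8, 12, 16, 24, 48} by decide]
  have hsum : (∑ δ ∈ ({1, 2, 3, 4, 6, 8, 12, 16, 24, 48} : Finset ℕ),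
      (δ : ℤ) * expFn [(2, 1), (4, -2), (6, 1), (8, 3), (12, 2), (24, -5)] δ) = (-(24 * 3 : ℕ) : ℤ) := by decide
  rw [hsum, cexp_neg_eq_inv_qParam_pow]
  rw [Finset.prod_insert (by decide), Finset.prod_insert (by decide), Finset.prod_insert (by decide), Finset.prod_insert (by decide), Finset.prod_insert (by decide), Finset.prod_insert (by decide), Finset.prod_insert (by decide), Finset.prod_insert (by decide), Finset.prod_insert (by decide),
    Finset.prod_singleton]
  rw [show expFn [(2, 1), (4, -2), (6, 1), (8, 3), (12, 2), (24, -5)] 1 = 0 by decide,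
    show expFn [(2, 1), (4, -2), (6, 1), (8, 3), (12, 2), (24, -5)] 2 = 1 by decide,
    show expFn [(2, 1), (4, -2), (6, 1), (8, 3), (12, 2), (24, -5)] 3 = 0 by decide,
    show expFn [(2, 1), (4, -2), (6, 1), (8, 3), (12, 2), (24, -5)] 4 = (-2) by decide,
    show expFn [(2, 1), (4, -2), (6, 1), (8, 3), (12, 2), (24, -5)] 6 = 1 by decide,
    show expFn [(2, 1), (4, -2), (6, 1), (8, 3), (12, 2), (24, -5)] 8 = 3 by decide,
    show expFn [(2, 1), (4, -2), (6, 1), (8, 3), (12, 2), (24, -5)] 12 = 2 by decide,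
    show expFn [(2, 1), (4, -2), (6, 1), (8, 3), (12, 2), (24, -5)] 16 = 0 by decide,
    show expFn [(2, 1), (4, -2), (6, 1), (8, 3), (12, 2), (24, -5)] 24 = (-5) by decide,
    show expFn [(2, 1), (4, -2), (6, 1), (8, 3), (12, 2), (24, -5)] 48 = 0 by decide]
  simp only [zpow_neg, zpow_ofNat]
  field_simp

/-- **`φ₄₈ = η₄⁴η₁₂⁴/(η₂η₆η₈η₂₄) = q E₄⁴E₁₂⁴/(E₂E₆E₈E₂₄)`.** [folklore] -/
theorem phi48_eq (τ : ℍ) :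
    etaQuotient 48 (expFn [(2, -1), (4, 4), (6, -1), (8, -1), (12, 4), (24, -1)]) τ
      = Function.Periodic.qParam 1 (τ : ℂ) * eulerFn 4 τ ^ 4 * eulerFn 12 τ ^ 4
        / (eulerFn 2 τ * eulerFn 6 τ * eulerFn 8 τ * eulerFn 24 τ) := by
  have hE2 := eulerFn_ne_zero (by norm_num : 0 < 2) τ
  have hE6 := eulerFn_ne_zero (by norm_num : 0 < 6) τ
  have hE8 := eulerFn_ne_zero (by norm_num : 0 < 8) τ
  have hE24 := eulerFn_ne_zero (by norm_num : 0 < 24) τ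
  have hq := qParam_ne_zero τ
  rw [etaQuotient_eq_cexp_mul_prod, show Nat.divisors 48 = {1, 2, 3, 4, 6, 8, 12, 16, 24, 48} by decide]
  have hsum : (∑ δ ∈ ({1, 2, 3, 4, 6, 8, 12, 16, 24, 48} : Finset ℕ),
      (δ : ℤ) * expFn [(2, -1), (4, 4), (6, -1), (8, -1), (12, 4), (24, -1)] δ) = ((24 : ℕ) : ℤ) := by decide
  rw [hsum]
  have hexp : cexp (2 * π * I * τ / 24 * (((24 : ℕ) : ℤ) : ℂ)) = Function.Periodic.qParam 1 (τ : ℂ) := by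
    rw [Function.Periodic.qParam]
    congr 1
    push_cast
    ring
  rw [hexp]
  rw [Finset.prod_insert (by decide), Finset.prod_insert (by decide), Finset.prod_insert (by decide), Finset.prod_insert (by decide), Finset.prod_insert (by decide), Finset.prod_insert (by decide), Finset.prod_insert (by decide), Finset.prod_insert (by decide), Finset.prod_insert (by decide),
    Finset.prod_singleton]
  rw [show expFn [(2, -1), (4, 4), (6, -1), (8, -1), (12, 4), (24, -1)] 1 = 0 by decide,
    show expFn [(2, -1), (4, 4), (6, -1), (8, -1), (12, 4), (24, -1)] 2 = (-1) by decide,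
    show expFn [(2, -1), (4, 4), (6, -1), (8, -1), (12, 4), (24, -1)] 3 = 0 by decide,
    show expFn [(2, -1), (4, 4), (6, -1), (8, -1), (12, 4), (24, -1)] 4 = 4 by decide,
    show expFn [(2, -1), (4, 4), (6, -1), (8, -1), (12, 4), (24, -1)] 6 = (-1) by decide,
    show expFn [(2, -1), (4, 4), (6, -1), (8, -1), (12, 4), (24, -1)] 8 = (-1) by decide,
    show expFn [(2, -1), (4, 4), (6, -1), (8, -1), (12, 4), (24, -1)] 12 = 4 by decide,
    show expFn [(2, -1), (4, 4), (6, -1), (8, -1), (12, 4), (24, -1)] 16 = 0 by decide,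
    show expFn [(2, -1), (4, 4), (6, -1), (8, -1), (12, 4), (24, -1)] 24 = (-1) by decide,
    show expFn [(2, -1), (4, 4), (6, -1), (8, -1), (12, 4), (24, -1)] 48 = 0 by decide]
  simp only [zpow_neg, zpow_ofNat]
  field_simp

/-! ## §2 The derivatives of `x` and `y` -/

/-- **`x′ = x · (4E₈′/E₈ + 2E₁₂′/E₁₂ − 2·2πi − 2E₄′/E₄ − 4E₂₄′/E₂₄)`.** [folklore] -/
theorem deriv_x48 (τ : ℍ) :
    deriv (etaQuotient 48 (expFn [(4, -2), (8, 4), (12, 2), (24, -4)]) ∘ ofComplex) τ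
      = eulerFn 8 τ ^ 4 * eulerFn 12 τ ^ 2
          / (Function.Periodic.qParam 1 (τ : ℂ) ^ 2 * eulerFn 4 τ ^ 2 * eulerFn 24 τ ^ 4)
        * (4 * deriv (eulerFn 8 ∘ ofComplex) τ / eulerFn 8 τ
          + 2 * deriv (eulerFn 12 ∘ ofComplex) τ / eulerFn 12 τ - 2 * (2 * π * I)
          - 2 * deriv (eulerFn 4 ∘ ofComplex) τ / eulerFn 4 τ
          - 4 * deriv (eulerFn 24 ∘ ofComplex) τ / eulerFn 24 τ) := by
  have hE4 := eulerFn_ne_zero (by norm_num : 0 < 4) τ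
  have hE8 := eulerFn_ne_zero (by norm_num : 0 < 8) τ
  have hE12 := eulerFn_ne_zero (by norm_num : 0 < 12) τ
  have hE24 := eulerFn_ne_zero (by norm_num : 0 < 24) τ
  have hq := qParam_ne_zero τ
  have hfun : (etaQuotient 48 (expFn [(4, -2), (8, 4), (12, 2), (24, -4)]) ∘ ofComplex) =ᶠ[𝓝 (τ : ℂ)]
      fun z ↦ (eulerFn 8 ∘ ofComplex) z ^ 4 * (eulerFn 12 ∘ ofComplex) z ^ 2
        / (Function.Periodic.qParam 1 z ^ 2 * (eulerFn 4 ∘ ofComplex) z ^ 2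
          * (eulerFn 24 ∘ ofComplex) z ^ 4) := by
    filter_upwards [isOpen_upperHalfPlaneSet.mem_nhds τ.im_pos] with z hz
    simp only [Function.comp_apply, x48_eq, ofComplex_apply_of_im_pos hz]
  rw [hfun.deriv_eq]
  have h4 := hasDerivAt_eulerFn_comp 4 τ
  have h8 := hasDerivAt_eulerFn_comp 8 τ
  have h12 := hasDerivAt_eulerFn_comp 12 τ
  have h24 := hasDerivAt_eulerFn_comp 24 τ
  have hqd : HasDerivAt (Function.Periodic.qParam 1) (2 * π * I * Function.Periodic.qParam 1 (τ : ℂ)) τ := by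
    simpa using hasDerivAt_qParam 1 (τ : ℂ)
  have hden : Function.Periodic.qParam 1 (τ : ℂ) ^ 2 * (eulerFn 4 ∘ ofComplex) τ ^ 2
      * (eulerFn 24 ∘ ofComplex) τ ^ 4 ≠ 0 := by
    simp only [Function.comp_apply, ofComplex_apply]
    exact mul_ne_zero (mul_ne_zero (pow_ne_zero _ hq) (pow_ne_zero _ hE4)) (pow_ne_zero _ hE24)
  have hD := ((h8.fun_pow 4).fun_mul (h12.fun_pow 2)).fun_div
    (((hqd.fun_pow 2).fun_mul (h4.fun_pow 2)).fun_mul (h24.fun_pow 4)) hden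
  rw [hD.deriv]
  simp only [Function.comp_apply, ofComplex_apply]
  field_simp
  ring

/-- **`y′ = y · (E₂′/E₂ + E₆′/E₆ + 3E₈′/E₈ + 2E₁₂′/E₁₂ − 3·2πi − 2E₄′/E₄ − 5E₂₄′/E₂₄)`.** [folklore] -/
theorem deriv_y48 (τ : ℍ) :
    deriv (etaQuotient 48 (expFn [(2, 1), (4, -2), (6, 1), (8, 3), (12, 2), (24, -5)]) ∘ ofComplex) τ
      = eulerFn 2 τ * eulerFn 6 τ * eulerFn 8 τ ^ 3 * eulerFn 12 τ ^ 2
          / (Function.Periodic.qParam 1 (τ : ℂ) ^ 3 * eulerFn 4 τ ^ 2 * eulerFn 24 τ ^ 5)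
        * (deriv (eulerFn 2 ∘ ofComplex) τ / eulerFn 2 τ
          + deriv (eulerFn 6 ∘ ofComplex) τ / eulerFn 6 τ
          + 3 * deriv (eulerFn 8 ∘ ofComplex) τ / eulerFn 8 τ
          + 2 * deriv (eulerFn 12 ∘ ofComplex) τ / eulerFn 12 τ - 3 * (2 * π * I)
          - 2 * deriv (eulerFn 4 ∘ ofComplex) τ / eulerFn 4 τ
          - 5 * deriv (eulerFn 24 ∘ ofComplex) τ / eulerFn 24 τ) := by
  have hE2 := eulerFn_ne_zero (by norm_num : 0 < 2) τ
  have hE4 := eulerFn_ne_zero (by norm_num : 0 < 4) τ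
  have hE6 := eulerFn_ne_zero (by norm_num : 0 < 6) τ
  have hE8 := eulerFn_ne_zero (by norm_num : 0 < 8) τ
  have hE12 := eulerFn_ne_zero (by norm_num : 0 < 12) τ
  have hE24 := eulerFn_ne_zero (by norm_num : 0 < 24) τ
  have hq := qParam_ne_zero τ
  have hfun : (etaQuotient 48 (expFn [(2, 1), (4, -2), (6, 1), (8, 3), (12, 2), (24, -5)]) ∘ ofComplex) =ᶠ[𝓝 (τ : ℂ)]
      fun z ↦ (eulerFn 2 ∘ ofComplex) z * (eulerFn 6 ∘ ofComplex) z * (eulerFn 8 ∘ ofComplex) z ^ 3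
          * (eulerFn 12 ∘ ofComplex) z ^ 2
        / (Function.Periodic.qParam 1 z ^ 3 * (eulerFn 4 ∘ ofComplex) z ^ 2
          * (eulerFn 24 ∘ ofComplex) z ^ 5) := by
    filter_upwards [isOpen_upperHalfPlaneSet.mem_nhds τ.im_pos] with z hz
    simp only [Function.comp_apply, y48_eq, ofComplex_apply_of_im_pos hz]
  rw [hfun.deriv_eq]
  have h2 := hasDerivAt_eulerFn_comp 2 τ
  have h4 := hasDerivAt_eulerFn_comp 4 τ
  have h6 := hasDerivAt_eulerFn_comp 6 τ
  have h8 := hasDerivAt_eulerFn_comp 8 τ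
  have h12 := hasDerivAt_eulerFn_comp 12 τ
  have h24 := hasDerivAt_eulerFn_comp 24 τ
  have hqd : HasDerivAt (Function.Periodic.qParam 1) (2 * π * I * Function.Periodic.qParam 1 (τ : ℂ)) τ := by
    simpa using hasDerivAt_qParam 1 (τ : ℂ)
  have hden : Function.Periodic.qParam 1 (τ : ℂ) ^ 3 * (eulerFn 4 ∘ ofComplex) τ ^ 2
      * (eulerFn 24 ∘ ofComplex) τ ^ 5 ≠ 0 := by
    simp only [Function.comp_apply, ofComplex_apply]
    exact mul_ne_zero (mul_ne_zero (pow_ne_zero _ hq) (pow_ne_zero _ hE4)) (pow_ne_zero _ hE24)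
  have hD := ((((h2.fun_mul h6).fun_mul (h8.fun_pow 3)).fun_mul (h12.fun_pow 2))).fun_div
    (((hqd.fun_pow 3).fun_mul (h4.fun_pow 2)).fun_mul (h24.fun_pow 5)) hden
  rw [hD.deriv]
  simp only [Function.comp_apply, ofComplex_apply]
  field_simp
  ring

/-! ## §3 `E₂`, `E₄`, `E₆`, `E₈` and their derivatives modulo `o(q⁹)` -/

/-- The first ten `q`-coefficients of `E_2`: `1,0,−1,0,−1,0,0,0,0,0`. [folklore] -/
theorem coeff_formalEulerScaled_two_le_nine (n : ℕ) (hn : n ≤ 9) :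
    PowerSeries.coeff n (formalEulerScaled 2) = if n = 0 then 1 else if n = 2 then -1 else if n = 4 then -1 else 0 := by
  have h0 := EulerRemaindersTwenty.coeff_formalEulerPow_one_le_six 0 (by norm_num)
  have h1 := EulerRemaindersTwenty.coeff_formalEulerPow_one_le_six 1 (by norm_num)
  have h2 := EulerRemaindersTwenty.coeff_formalEulerPow_one_le_six 2 (by norm_num)
  have h3 := EulerRemaindersTwenty.coeff_formalEulerPow_one_le_six 3 (by norm_num)
  have h4 := EulerRemaindersTwenty.coeff_formalEulerPow_one_le_six 4 (by norm_num)
  simp only at h0 h1 h2 h3 h4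
  interval_cases n <;> simp +decide [coeff_formalEulerScaled, h0, h1, h2, h3, h4]

/-- **`E_2 = 1 − q² − q⁴ + o(q⁹)`.** [folklore] -/
theorem tendsto_eulerFn_two_nine :
    Tendsto (fun τ : ℍ ↦ (eulerFn 2 τ - (1 - X ^ 2 - X ^ 4 : ℂ[X]).eval (Function.Periodic.qParam 1 (τ : ℂ)))
      / Function.Periodic.qParam 1 (τ : ℂ) ^ 9) atImInfty (𝓝 0) := by
  refine congr_poly ?_ (tendsto_of_hasSum (periodic_eulerFn 2) (mdifferentiable_eulerFn 2)
    (isBoundedAtImInfty_eulerFn (by norm_num)) (hasSum_eulerFn (by norm_num)) 9)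
  have h := coeff_formalEulerScaled_two_le_nine
  simp only [Finset.sum_range_succ, Finset.sum_range_zero, h 0 (by norm_num), h 1 (by norm_num), h 2 (by norm_num), h 3 (by norm_num), h 4 (by norm_num), h 5 (by norm_num), h 6 (by norm_num), h 7 (by norm_num), h 8 (by norm_num), h 9 (by norm_num)]
  norm_num
  ring

/-- **`E_2′ = 2πi(−2q² − 4q⁴) + o(q⁹)`.** [folklore] -/
theorem tendsto_deriv_eulerFn_two_nine :
    Tendsto (fun τ : ℍ ↦ (deriv (eulerFn 2 ∘ ofComplex) τ
      - (C (2 * π * I) * (-2 * X ^ 2 - 4 * X ^ 4) : ℂ[X]).eval (Function.Periodic.qParam 1 (τ : ℂ)))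
      / Function.Periodic.qParam 1 (τ : ℂ) ^ 9) atImInfty (𝓝 0) := by
  refine congr_poly ?_ (congr_fun (fun τ ↦ deriv_eulerFn_sub_one 2 τ)
    (tendsto_deriv_of_isCuspFunction (isCuspFunction_eulerFn_sub_one (by norm_num : 0 < 2)) 9))
  have h := coeff_formalEulerScaled_two_le_nine
  have hc : ∀ n : ℕ, n ≠ 0 → n ≤ 9 → (qExpansion 1 (eulerFn 2 - 1)).coeff n
      = (((if n = 0 then 1 else if n = 2 then -1 else if n = 4 then -1 else 0 : ℤ)) : ℂ) :=
    fun n hn hn9 ↦ by rw [qExpansion_eulerFn_sub_one_coeff_of_ne_zero (by norm_num) hn, h n hn9]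
  simp only [Finset.sum_range_succ, Finset.sum_range_zero, hc 1 (by norm_num) (by norm_num),
    hc 2 (by norm_num) (by norm_num),
    hc 3 (by norm_num) (by norm_num),
    hc 4 (by norm_num) (by norm_num),
    hc 5 (by norm_num) (by norm_num),
    hc 6 (by norm_num) (by norm_num),
    hc 7 (by norm_num) (by norm_num),
    hc 8 (by norm_num) (by norm_num),
    hc 9 (by norm_num) (by norm_num)]
  norm_num
  simp only [map_ofNat]
  ring

/-- The first ten `q`-coefficients of `E_4`: `1,0,0,0,−1,0,0,0,−1,0`. [folklore] -/
theorem coeff_formalEulerScaled_four_le_nine (n : ℕ) (hn : n ≤ 9) :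
    PowerSeries.coeff n (formalEulerScaled 4) = if n = 0 then 1 else if n = 4 then -1 else if n = 8 then -1 else 0 := by
  have h0 := EulerRemaindersTwenty.coeff_formalEulerPow_one_le_six 0 (by norm_num)
  have h1 := EulerRemaindersTwenty.coeff_formalEulerPow_one_le_six 1 (by norm_num)
  have h2 := EulerRemaindersTwenty.coeff_formalEulerPow_one_le_six 2 (by norm_num)
  simp only at h0 h1 h2
  interval_cases n <;> simp +decide [coeff_formalEulerScaled, h0, h1, h2]

/-- **`E_4 = 1 − q⁴ − q⁸ + o(q⁹)`.** [folklore] -/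
theorem tendsto_eulerFn_four_nine :
    Tendsto (fun τ : ℍ ↦ (eulerFn 4 τ - (1 - X ^ 4 - X ^ 8 : ℂ[X]).eval (Function.Periodic.qParam 1 (τ : ℂ)))
      / Function.Periodic.qParam 1 (τ : ℂ) ^ 9) atImInfty (𝓝 0) := by
  refine congr_poly ?_ (tendsto_of_hasSum (periodic_eulerFn 4) (mdifferentiable_eulerFn 4)
    (isBoundedAtImInfty_eulerFn (by norm_num)) (hasSum_eulerFn (by norm_num)) 9)
  have h := coeff_formalEulerScaled_four_le_nine
  simp only [Finset.sum_range_succ, Finset.sum_range_zero, h 0 (by norm_num), h 1 (by norm_num), h 2 (by norm_num), h 3 (by norm_num), h 4 (by norm_num), h 5 (by norm_num), h 6 (by norm_num), h 7 (by norm_num), h 8 (by norm_num), h 9 (by norm_num)]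
  norm_num
  ring

/-- **`E_4′ = 2πi(−4q⁴ − 8q⁸) + o(q⁹)`.** [folklore] -/
theorem tendsto_deriv_eulerFn_four_nine :
    Tendsto (fun τ : ℍ ↦ (deriv (eulerFn 4 ∘ ofComplex) τ
      - (C (2 * π * I) * (-4 * X ^ 4 - 8 * X ^ 8) : ℂ[X]).eval (Function.Periodic.qParam 1 (τ : ℂ)))
      / Function.Periodic.qParam 1 (τ : ℂ) ^ 9) atImInfty (𝓝 0) := by
  refine congr_poly ?_ (congr_fun (fun τ ↦ deriv_eulerFn_sub_one 4 τ)
    (tendsto_deriv_of_isCuspFunction (isCuspFunction_eulerFn_sub_one (by norm_num : 0 < 4)) 9))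
  have h := coeff_formalEulerScaled_four_le_nine
  have hc : ∀ n : ℕ, n ≠ 0 → n ≤ 9 → (qExpansion 1 (eulerFn 4 - 1)).coeff n
      = (((if n = 0 then 1 else if n = 4 then -1 else if n = 8 then -1 else 0 : ℤ)) : ℂ) :=
    fun n hn hn9 ↦ by rw [qExpansion_eulerFn_sub_one_coeff_of_ne_zero (by norm_num) hn, h n hn9]
  simp only [Finset.sum_range_succ, Finset.sum_range_zero, hc 1 (by norm_num) (by norm_num),
    hc 2 (by norm_num) (by norm_num),
    hc 3 (by norm_num) (by norm_num),
    hc 4 (by norm_num) (by norm_num),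
    hc 5 (by norm_num) (by norm_num),
    hc 6 (by norm_num) (by norm_num),
    hc 7 (by norm_num) (by norm_num),
    hc 8 (by norm_num) (by norm_num),
    hc 9 (by norm_num) (by norm_num)]
  norm_num
  simp only [map_ofNat]
  ring

/-- The first ten `q`-coefficients of `E_6`: `1,0,0,0,0,0,−1,0,0,0`. [folklore] -/
theorem coeff_formalEulerScaled_six_le_nine (n : ℕ) (hn : n ≤ 9) :
    PowerSeries.coeff n (formalEulerScaled 6) = if n = 0 then 1 else if n = 6 then -1 else 0 := by
  have h0 := EulerRemaindersTwenty.coeff_formalEulerPow_one_le_six 0 (by norm_num)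
  have h1 := EulerRemaindersTwenty.coeff_formalEulerPow_one_le_six 1 (by norm_num)
  simp only at h0 h1
  interval_cases n <;> simp +decide [coeff_formalEulerScaled, h0, h1]

/-- **`E_6 = 1 − q⁶ + o(q⁹)`.** [folklore] -/
theorem tendsto_eulerFn_six_nine :
    Tendsto (fun τ : ℍ ↦ (eulerFn 6 τ - (1 - X ^ 6 : ℂ[X]).eval (Function.Periodic.qParam 1 (τ : ℂ)))
      / Function.Periodic.qParam 1 (τ : ℂ) ^ 9) atImInfty (𝓝 0) := by
  refine congr_poly ?_ (tendsto_of_hasSum (periodic_eulerFn 6) (mdifferentiable_eulerFn 6)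
    (isBoundedAtImInfty_eulerFn (by norm_num)) (hasSum_eulerFn (by norm_num)) 9)
  have h := coeff_formalEulerScaled_six_le_nine
  simp only [Finset.sum_range_succ, Finset.sum_range_zero, h 0 (by norm_num), h 1 (by norm_num), h 2 (by norm_num), h 3 (by norm_num), h 4 (by norm_num), h 5 (by norm_num), h 6 (by norm_num), h 7 (by norm_num), h 8 (by norm_num), h 9 (by norm_num)]
  norm_num
  ring

/-- **`E_6′ = 2πi(−6q⁶) + o(q⁹)`.** [folklore] -/
theorem tendsto_deriv_eulerFn_six_nine :
    Tendsto (fun τ : ℍ ↦ (deriv (eulerFn 6 ∘ ofComplex) τ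
      - (C (2 * π * I) * (-6 * X ^ 6) : ℂ[X]).eval (Function.Periodic.qParam 1 (τ : ℂ)))
      / Function.Periodic.qParam 1 (τ : ℂ) ^ 9) atImInfty (𝓝 0) := by
  refine congr_poly ?_ (congr_fun (fun τ ↦ deriv_eulerFn_sub_one 6 τ)
    (tendsto_deriv_of_isCuspFunction (isCuspFunction_eulerFn_sub_one (by norm_num : 0 < 6)) 9))
  have h := coeff_formalEulerScaled_six_le_nine
  have hc : ∀ n : ℕ, n ≠ 0 → n ≤ 9 → (qExpansion 1 (eulerFn 6 - 1)).coeff n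
      = (((if n = 0 then 1 else if n = 6 then -1 else 0 : ℤ)) : ℂ) :=
    fun n hn hn9 ↦ by rw [qExpansion_eulerFn_sub_one_coeff_of_ne_zero (by norm_num) hn, h n hn9]
  simp only [Finset.sum_range_succ, Finset.sum_range_zero, hc 1 (by norm_num) (by norm_num),
    hc 2 (by norm_num) (by norm_num),
    hc 3 (by norm_num) (by norm_num),
    hc 4 (by norm_num) (by norm_num),
    hc 5 (by norm_num) (by norm_num),
    hc 6 (by norm_num) (by norm_num),
    hc 7 (by norm_num) (by norm_num),
    hc 8 (by norm_num) (by norm_num),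
    hc 9 (by norm_num) (by norm_num)]
  norm_num
  simp only [map_ofNat]
  ring

/-- The first ten `q`-coefficients of `E_8`: `1,0,0,0,0,0,0,0,−1,0`. [folklore] -/
theorem coeff_formalEulerScaled_eight_le_nine (n : ℕ) (hn : n ≤ 9) :
    PowerSeries.coeff n (formalEulerScaled 8) = if n = 0 then 1 else if n = 8 then -1 else 0 := by
  have h0 := EulerRemaindersTwenty.coeff_formalEulerPow_one_le_six 0 (by norm_num)
  have h1 := EulerRemaindersTwenty.coeff_formalEulerPow_one_le_six 1 (by norm_num)
  simp only at h0 h1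
  interval_cases n <;> simp +decide [coeff_formalEulerScaled, h0, h1]

/-- **`E_8 = 1 − q⁸ + o(q⁹)`.** [folklore] -/
theorem tendsto_eulerFn_eight_nine :
    Tendsto (fun τ : ℍ ↦ (eulerFn 8 τ - (1 - X ^ 8 : ℂ[X]).eval (Function.Periodic.qParam 1 (τ : ℂ)))
      / Function.Periodic.qParam 1 (τ : ℂ) ^ 9) atImInfty (𝓝 0) := by
  refine congr_poly ?_ (tendsto_of_hasSum (periodic_eulerFn 8) (mdifferentiable_eulerFn 8)
    (isBoundedAtImInfty_eulerFn (by norm_num)) (hasSum_eulerFn (by norm_num)) 9)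
  have h := coeff_formalEulerScaled_eight_le_nine
  simp only [Finset.sum_range_succ, Finset.sum_range_zero, h 0 (by norm_num), h 1 (by norm_num), h 2 (by norm_num), h 3 (by norm_num), h 4 (by norm_num), h 5 (by norm_num), h 6 (by norm_num), h 7 (by norm_num), h 8 (by norm_num), h 9 (by norm_num)]
  norm_num
  ring

/-- **`E_8′ = 2πi(−8q⁸) + o(q⁹)`.** [folklore] -/
theorem tendsto_deriv_eulerFn_eight_nine :
    Tendsto (fun τ : ℍ ↦ (deriv (eulerFn 8 ∘ ofComplex) τ
      - (C (2 * π * I) * (-8 * X ^ 8) : ℂ[X]).eval (Function.Periodic.qParam 1 (τ : ℂ)))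
      / Function.Periodic.qParam 1 (τ : ℂ) ^ 9) atImInfty (𝓝 0) := by
  refine congr_poly ?_ (congr_fun (fun τ ↦ deriv_eulerFn_sub_one 8 τ)
    (tendsto_deriv_of_isCuspFunction (isCuspFunction_eulerFn_sub_one (by norm_num : 0 < 8)) 9))
  have h := coeff_formalEulerScaled_eight_le_nine
  have hc : ∀ n : ℕ, n ≠ 0 → n ≤ 9 → (qExpansion 1 (eulerFn 8 - 1)).coeff n
      = (((if n = 0 then 1 else if n = 8 then -1 else 0 : ℤ)) : ℂ) :=
    fun n hn hn9 ↦ by rw [qExpansion_eulerFn_sub_one_coeff_of_ne_zero (by norm_num) hn, h n hn9]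
  simp only [Finset.sum_range_succ, Finset.sum_range_zero, hc 1 (by norm_num) (by norm_num),
    hc 2 (by norm_num) (by norm_num),
    hc 3 (by norm_num) (by norm_num),
    hc 4 (by norm_num) (by norm_num),
    hc 5 (by norm_num) (by norm_num),
    hc 6 (by norm_num) (by norm_num),
    hc 7 (by norm_num) (by norm_num),
    hc 8 (by norm_num) (by norm_num),
    hc 9 (by norm_num) (by norm_num)]
  norm_num
  simp only [map_ofNat]
  ring

end Summit.BirchSwinnertonDyer.BirchSwinnertonDyer.Theorems.ManinLocalTwoThree.EulerRemaindersFortyEight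

end
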